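import Literature.NumberTheory.Automorphic.ShimuraCurveDataExistence
import Literature.NumberTheory.Automorphic.HypFundamentalDomainVolume
import Literature.NumberTheory.Automorphic.EichlerOrdersMatrixRat
import Literature.NumberTheory.Automorphic.BrandtDataRingEquiv
import Literature.NumberTheory.Automorphic.QuaternionAlgebraAdelicMatrixProofs
import Literature.NumberTheory.QuadraticForms.HasseNormTheoremHolds
import Literature.LinearAlgebra.Matrix.MatrixAlgHomConj
import HarnessLib

/-!
# Shimizu's volume formula for `X₀^D(M)`, the split case `D = 1`:
# `vol(X.fd) = (π/3) ψ(M)` for EVERY Shimura curve datum of level `(1, M)`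

Topic `NumberTheory/Automorphic`; theorems only (no definition, no named fact, no instance).
This file proves the case `D = 1` of the named fact
`Literature.NumberTheory.Automorphic.ShimuraCurveData.volume_fd_eq` (Shimizu 1963; Vignéras,
LNM 800, Ch. IV §3.A, p. 120 of the book = PDF p. 101 of the held copy: for a congruence group of
level `N = N₀N₁N₂` in `H ⊆ M(2,ℝ)` of reduced discriminant `D`,
`vol_a(Γ̄∖ℋ₂) = -(1/6) ∏_{p∣D}(p-1) · N₀N₁²N₂³ ∏_{p∣N₀}(1+p⁻¹) ∏_{p∣N₁N₂}(1-p⁻²)` for the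
Euler–Poincaré measure `-dx dy/(2π y²)` (IV §2, p. 119); here `N₀ = M`, `N₁ = N₂ = 1`,
`Γ = O¹`), verbatim:

* `ShimuraCurveData.volume_fd_eq_of_discr_one` — for every datum `X : ShimuraCurveData 1 M` and
  `0 < M`, `volume X.fd = ENNReal.ofReal (π / 3 * ((Nat.totient 1 * gamma0Index M : ℕ) : ℝ))`.

A datum of level `(1, M)` is an ARBITRARY quaternion algebra `B/ℚ` with no ramified finite place,
an ARBITRARY Eichler order `O ⊆ B` of level `M`, an ARBITRARY injective `ι : B →ₐ[ℚ] M₂(ℝ)` and an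
ARBITRARY measurable a.e. fundamental domain of `ι(O¹)`; the proof assembles the bricks already in
the tree along the classical road (Vignéras IV §1–§2, Shimura 1971 Prop. 1.43):

1. (`isSplitAtInfinite_of_algHom_real`) a quaternion algebra over `ℚ` with a `ℚ`-algebra map to
   `M₂(ℝ)` is split at the infinite place: `ℝ ⊗_ℚ B → M₂(ℝ)` is an isomorphism (simplicity and
   dimension `4`), so in a model `B ≃ ℍ[ℚ,a,b]` the equation `x² - a y² = b` is solvable in `ℝ`
   (Vignéras I §2 Cor. 2.4, tree `QuaternionAlgebra.nonempty_algEquiv_matrix_iff`), hence in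
   Mathlib's completion `ℚ_∞ ≃+* ℝ`;
2. (`ShimuraCurveData.nonempty_algEquiv_matrix_of_discr_one`) hence for `D = 1` the algebra has
   the ramification of `M₂(ℚ)` (none), so **`B ≃ₐ[ℚ] M₂(ℚ)`** by the uniqueness half of the
   classification (Vignéras III §3 Thm. 3.1, tree `nonempty_algEquiv_of_ramifiedPlaces_eq_holds`,
   PROVED in the tree from Hasse's norm theorem);
3. (`ShimuraCurveData.exists_conjAct_inv_smul_Gamma_eq_of_discr_one`) transporting `O` to
   `M₂(ℚ)` gives an Eichler order of level `M`, which is `u (ℤ ℤ; Mℤ ℤ) u⁻¹`, `u ∈ GL₂(ℚ)`, and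
   `0 < M` (tree `Brandt.IsEichlerOrder.exists_units_forall_mem_iff_and_pos`, Vignéras II §2); the
   real splitting `ι ∘ e⁻¹ : M₂(ℚ) → M₂(ℝ)` is `x ↦ g x g⁻¹` (Skolem–Noether for matrix algebras,
   tree `exists_algHom_apply_eq_conj`); so with `h = g u`,
   **`h⁻¹ Γ₀^1(M) h = Γ₀(M)`** (the image of Mathlib's `CongruenceSubgroup.Gamma0 M` in `GL₂(ℝ)`);
4. (`ShimuraCurveData.volume_fd_eq_of_discr_one`) `h⁻¹ X.fd` is a fundamental domain of `Γ₀(M)`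
   (tree `IsHypFundamentalDomain.conjAct_inv_smul`) of the same area (invariance of `dx dy/y²`),
   and EVERY fundamental domain of `Γ₀(M)` has area `(π/3) [SL₂(ℤ) : Γ₀(M)] = (π/3) ψ(M)` (tree
   `volume_eq_of_isHypFundamentalDomain_gamma0`: coset unfolding over the standard domain of
   `SL₂(ℤ)`, `vol = π/3`, and `index_gamma0_eq_gamma0Index_holds`).

The case `D > 1` (cocompact `ι(O¹)` in a division algebra) is Vignéras IV §1 Thm. 1.1 / Cor. 1.8
with `τ(H¹) = 1` and is NOT treated here.

## References

* M.-F. Vignéras, *Arithmétique des algèbres de quaternions*, LNM 800 (1980), Ch. IV §1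
  (Thm. 1.1, exemple 4), §2 (mesure d'Euler–Poincaré), §3.A (volume des groupes de congruence);
  Ch. III §3 Thm. 3.1; Ch. II §2 [VignerasLNM800].
* H. Shimizu, *On discontinuous groups operating on the product of the upper half planes*,
  Ann. of Math. 77 (1963) [Shimizu1963].
* G. Shimura, *Introduction to the arithmetic theory of automorphic functions* (1971), Prop. 1.43.

## Mathlib / tree search

Tree: `nonempty_algEquiv_of_ramifiedPlaces_eq_holds` (`QuadraticForms/HasseNormTheoremHolds`),
`ramifiedPlaces_matrix`, `ramifiedInfinitePlaces_matrix`, `isQuaternionAlgebra_matrix`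
(`QuaternionAlgebraAdelicMatrixProofs`), `IsSplitAtInfinite.of_algEquiv`
(`ShimuraCurveDataExistence`), `isSplitAtInfinite_quaternionAlgebra_iff`,
`QuaternionAlgebra.nonempty_baseChange_algEquiv`, `QuaternionAlgebra.nonempty_algEquiv_matrix_iff`
(`QuaternionAlgebraSplitting`), `Brandt.IsEichlerOrder.map_ringEquiv` (`BrandtDataRingEquiv`),
`Brandt.IsEichlerOrder.exists_units_forall_mem_iff_and_pos` (`EichlerOrdersMatrixRat`),
`exists_algHom_apply_eq_conj` (`LinearAlgebra/Matrix/MatrixAlgHomConj`),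
`IsHypFundamentalDomain.conjAct_inv_smul`, `mem_conjAct_inv_smul_iff`
(`FundamentalDomainCosetUnfolding`), `volume_eq_of_isHypFundamentalDomain_gamma0`
(`HypFundamentalDomainVolume`). Mathlib: `InfinitePlace.Completion.ringEquivRealOfIsReal`,
`Matrix.SpecialLinearGroup.mapGL_coe_matrix`, `CongruenceSubgroup.Gamma0_mem`,
`MeasureTheory.measure_smul`. No statement of 1–4 exists in Mathlib or the tree
(`lean search 'volume_fd_eq|IsSplitAtInfinite.*algHom|Gamma0.*conj'`).
-/

noncomputable section

open scoped MatrixGroups TensorProduct Quaternion Pointwise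
open _root_.MeasureTheory NumberField IsDedekindDomain Matrix

namespace Literature.NumberTheory.Automorphic

/-! ## 1. A quaternion algebra over `ℚ` with a real representation is split at infinity -/

section SplitAtInfinity

variable {B : Type*} [Ring B] [Algebra ℚ B] [IsQuaternionAlgebra ℚ B]

/-- **A real representation is a real splitting**: a `ℚ`-algebra map `ι : B → M₂(ℝ)` of a
quaternion algebra `B/ℚ` induces an isomorphism `ℝ ⊗_ℚ B ≃ₐ[ℝ] M₂(ℝ)` (`r ⊗ x ↦ r ι(x)`):
injective because `ℝ ⊗_ℚ B` is simple (a quaternion algebra over `ℝ`), bijective by dimension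
`4 = 4` (Vignéras IV §1, `H ⊗ ℝ ≅ M(2,ℝ)`). [cite: VignerasLNM800, Ch. IV §1 (plongement φ)] -/
theorem nonempty_realSplitting_of_algHom (ι : B →ₐ[ℚ] Matrix (Fin 2) (Fin 2) ℝ) :
    ∃ E : ℝ ⊗[ℚ] B ≃ₐ[ℝ] Matrix (Fin 2) (Fin 2) ℝ, ∀ x, E ((1 : ℝ) ⊗ₜ[ℚ] x) = ι x := by
  let f : ℝ ⊗[ℚ] B →ₐ[ℝ] Matrix (Fin 2) (Fin 2) ℝ :=
    Algebra.TensorProduct.lift (Algebra.ofId ℝ (Matrix (Fin 2) (Fin 2) ℝ)) ι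
      (fun r b => Algebra.commutes r (ι b))
  haveI hQ : IsQuaternionAlgebra ℝ (ScalarExtension ℚ ℝ B) := isQuaternionAlgebra_scalarExtension ℚ B ℝ
  haveI : IsSimpleRing (ℝ ⊗[ℚ] B) := IsQuaternionAlgebra.isSimpleRing' ℝ (ScalarExtension ℚ ℝ B)
  have hfin : Module.finrank ℝ (ℝ ⊗[ℚ] B) = Module.finrank ℝ (Matrix (Fin 2) (Fin 2) ℝ) := by
    rw [Module.finrank_baseChange, IsQuaternionAlgebra.finrank_eq_four (K := ℚ) (D := B),
      Module.finrank_matrix]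
    simp
  have hinj : Function.Injective f := RingHom.injective f.toRingHom
  have hsurj : Function.Surjective f :=
    (LinearMap.injective_iff_surjective_of_finrank_eq_finrank hfin (f := f.toLinearMap)).mp hinj
  refine ⟨AlgEquiv.ofBijective f ⟨hinj, hsurj⟩, fun x => ?_⟩
  change f ((1 : ℝ) ⊗ₜ[ℚ] x) = ι x
  change Algebra.TensorProduct.lift _ _ _ ((1 : ℝ) ⊗ₜ[ℚ] x) = _
  rw [Algebra.TensorProduct.lift_tmul, map_one, one_mul]

/-- **A quaternion algebra over `ℚ` with a real representation is split at the infinite place**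
(`IsSplitAtInfinite`, i.e. `ℚ_∞ ⊗_ℚ B ≃ M₂(ℚ_∞)` for Mathlib's completion `ℚ_∞ ≃+* ℝ`): in a
model `B ≃ ℍ[ℚ,a,b]` (tree `IsQuaternionAlgebra.exists_algEquiv_quaternionAlgebra`) the real
splitting gives `ℍ[ℝ,a,b] ≃ M₂(ℝ)`, so `x² - a y² = b` is solvable in `ℝ` (Vignéras I §2 Cor. 2.4,
tree `QuaternionAlgebra.nonempty_algEquiv_matrix_iff`), hence in `ℚ_∞`, which is the criterion
`isSplitAtInfinite_quaternionAlgebra_iff` (tree). [cite: VignerasLNM800, Ch. I §2 Cor. 2.4 and Ch. III §3 (places infinies)] -/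
theorem isSplitAtInfinite_of_algHom_real (ι : B →ₐ[ℚ] Matrix (Fin 2) (Fin 2) ℝ)
    (w : InfinitePlace ℚ) : IsSplitAtInfinite B w := by
  obtain ⟨a, b, ha, hb, ⟨e⟩⟩ :=
    IsQuaternionAlgebra.exists_algEquiv_quaternionAlgebra (K := ℚ) (D := B)
  haveI : IsQuaternionAlgebra ℚ ℍ[ℚ,a,b] := QuaternionAlgebra.isQuaternionAlgebra_holds ha hb
  -- the real splitting of the model
  obtain ⟨E, -⟩ := nonempty_realSplitting_of_algHom (ι.comp (e.symm : ℍ[ℚ,a,b] →ₐ[ℚ] B))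
  obtain ⟨e₁⟩ := QuaternionAlgebra.nonempty_baseChange_algEquiv ℚ ℝ a b
  have ha' : (algebraMap ℚ ℝ a) ≠ 0 := (map_ne_zero _).mpr ha
  have hb' : (algebraMap ℚ ℝ b) ≠ 0 := (map_ne_zero _).mpr hb
  obtain ⟨x, y, hxy⟩ := (QuaternionAlgebra.nonempty_algEquiv_matrix_iff ha' hb').mp ⟨e₁.symm.trans E⟩
  -- transport the real solution to the completion `ℚ_w ≃+* ℝ`
  have hw : w.IsReal := IsTotallyReal.isReal w
  let φ := (InfinitePlace.Completion.ringEquivRealOfIsReal hw).symm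
  have hφ : ∀ c : ℚ, algebraMap ℚ w.Completion c = φ (algebraMap ℚ ℝ c) := fun c => by
    apply (InfinitePlace.Completion.ringEquivRealOfIsReal hw).injective
    rw [RingEquiv.apply_symm_apply, InfinitePlace.Completion.ringEquivRealOfIsReal_apply]
    exact (eq_ratCast ((InfinitePlace.Completion.extensionEmbeddingOfIsReal hw).comp
      (algebraMap ℚ w.Completion)) c).trans (eq_ratCast (algebraMap ℚ ℝ) c).symm
  refine IsSplitAtInfinite.of_algEquiv e w
    ((isSplitAtInfinite_quaternionAlgebra_iff ℚ ha hb w).mpr ⟨φ x, φ y, ?_⟩)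
  rw [hφ a, hφ b, ← hxy, map_sub, map_mul, map_pow, map_pow]

/-- Hence such an algebra has no ramified infinite place. [cite: VignerasLNM800, Ch. III §3 (places infinies)] -/
theorem ramifiedInfinitePlaces_eq_empty_of_algHom_real (ι : B →ₐ[ℚ] Matrix (Fin 2) (Fin 2) ℝ) :
    ramifiedInfinitePlaces ℚ B = ∅ :=
  Set.eq_empty_of_forall_notMem fun w hw => hw (isSplitAtInfinite_of_algHom_real ι w)

end SplitAtInfinity

/-! ## 2. The algebra of a datum of discriminant `1` is `M₂(ℚ)` -/

section DiscrOne

variable {M : ℕ}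

/-- A datum of discriminant `D = 1` has no ramified finite place (`p ∣ 1` has no prime solution).
[folklore] -/
theorem ShimuraCurveData.ramifiedPlaces_eq_empty_of_discr_one (X : ShimuraCurveData 1 M) :
    ramifiedPlaces ℚ X.B = ∅ := by
  rw [X.ramifiedPlaces_eq]
  refine Set.eq_empty_of_forall_notMem fun v hv => ?_
  rw [Set.mem_setOf_eq, Nat.dvd_one] at hv
  exact (Rat.HeightOneSpectrum.primesEquiv v).prop.ne_one hv

/-- **The quaternion algebra of a Shimura curve datum of discriminant `1` is `M₂(ℚ)`**: it is
unramified at every finite place (`D = 1`) and at infinity (it embeds in `M₂(ℝ)`), as is `M₂(ℚ)`,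
so the uniqueness half of the classification applies (Vignéras III §3 Thm. 3.1, tree
`nonempty_algEquiv_of_ramifiedPlaces_eq_holds`). [cite: VignerasLNM800, Ch. III §3 Thm. 3.1] -/
theorem ShimuraCurveData.nonempty_algEquiv_matrix_of_discr_one (X : ShimuraCurveData 1 M) :
    Nonempty (X.B ≃ₐ[ℚ] Matrix (Fin 2) (Fin 2) ℚ) := by
  haveI : IsQuaternionAlgebra ℚ (Matrix (Fin 2) (Fin 2) ℚ) := isQuaternionAlgebra_matrix ℚ
  refine nonempty_algEquiv_of_ramifiedPlaces_eq_holds ℚ X.B (Matrix (Fin 2) (Fin 2) ℚ) ?_ ?_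
  · rw [X.ramifiedPlaces_eq_empty_of_discr_one, ramifiedPlaces_matrix]
  · rw [ramifiedInfinitePlaces_eq_empty_of_algHom_real X.ι, ramifiedInfinitePlaces_matrix]

end DiscrOne

/-! ## 3. `Γ₀^1(M) = ι(O¹)` is a `GL₂(ℝ)`-conjugate of `Γ₀(M)` -/

section Conjugate

variable {M : ℕ}

/-- The real cast of an integer matrix through `ℚ`: `(w^ℚ)^ℝ = w^ℝ`. [folklore] -/
theorem map_intCast_map_algebraMap (w : Matrix (Fin 2) (Fin 2) ℤ) :
    (w.map (Int.cast : ℤ → ℚ)).map (algebraMap ℚ ℝ) = w.map (algebraMap ℤ ℝ) := by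
  ext i j
  simp only [map_apply, eq_ratCast, Rat.cast_intCast, eq_intCast]

/-- For the data of step 3 (an isomorphism `e : B ≃ M₂(ℚ)` carrying `O` onto `u O₀(M) u⁻¹` and a
conjugator `g` of the real splitting `ι ∘ e⁻¹`), every `w ∈ Γ₀(M)` gives an element
`x = e⁻¹(u w u⁻¹) ∈ O` with `ι(x) = h w h⁻¹`, `h = g u`. [folklore] -/
theorem ShimuraCurveData.exists_mem_O_ι_eq_conj (X : ShimuraCurveData 1 M)
    (e : X.B ≃ₐ[ℚ] Matrix (Fin 2) (Fin 2) ℚ) (u : (Matrix (Fin 2) (Fin 2) ℚ)ˣ)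
    (hu : ∀ z : Matrix (Fin 2) (Fin 2) ℚ,
      z ∈ X.O.map ((e : X.B ≃+* Matrix (Fin 2) (Fin 2) ℚ).toAddEquiv.toIntLinearEquiv :
        X.B →ₗ[ℤ] Matrix (Fin 2) (Fin 2) ℚ) ↔
      (∀ i j, ∃ n : ℤ, (((u⁻¹ : (Matrix (Fin 2) (Fin 2) ℚ)ˣ) : Matrix (Fin 2) (Fin 2) ℚ) * z * u) i j = n) ∧
        ∃ n : ℤ, (((u⁻¹ : (Matrix (Fin 2) (Fin 2) ℚ)ˣ) : Matrix (Fin 2) (Fin 2) ℚ) * z * u) 1 0 = M * n)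
    (g uR : GL (Fin 2) ℝ)
    (huR : uR = Units.map ((algebraMap ℚ ℝ).mapMatrix :
      Matrix (Fin 2) (Fin 2) ℚ →+* Matrix (Fin 2) (Fin 2) ℝ).toMonoidHom u)
    (hg : ∀ x : Matrix (Fin 2) (Fin 2) ℚ, (X.ι.comp (e.symm : Matrix (Fin 2) (Fin 2) ℚ →ₐ[ℚ] X.B)) x =
      (g : Matrix (Fin 2) (Fin 2) ℝ) * x.map (algebraMap ℚ ℝ) * ((g⁻¹ : GL (Fin 2) ℝ) : Matrix (Fin 2) (Fin 2) ℝ))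
    (w : SL(2, ℤ)) (hw : w ∈ CongruenceSubgroup.Gamma0 M) :
    ∃ x ∈ X.O, X.ι x =
      ((g * uR * Matrix.SpecialLinearGroup.mapGL ℝ w * (g * uR)⁻¹ : GL (Fin 2) ℝ) :
        Matrix (Fin 2) (Fin 2) ℝ) := by
  set wQ : Matrix (Fin 2) (Fin 2) ℚ := (w : Matrix (Fin 2) (Fin 2) ℤ).map (Int.cast : ℤ → ℚ) with hwQ
  set z : Matrix (Fin 2) (Fin 2) ℚ := (u : Matrix (Fin 2) (Fin 2) ℚ) * wQ *
    ((u⁻¹ : (Matrix (Fin 2) (Fin 2) ℚ)ˣ) : Matrix (Fin 2) (Fin 2) ℚ) with hz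
  -- `u⁻¹ z u = w` is integral with `M ∣ w₁₀`
  have hconj : ((u⁻¹ : (Matrix (Fin 2) (Fin 2) ℚ)ˣ) : Matrix (Fin 2) (Fin 2) ℚ) * z * u = wQ := by
    rw [hz, ← mul_assoc, ← mul_assoc, Units.inv_mul, one_mul, Units.inv_mul_cancel_right]
  have hzO : z ∈ X.O.map ((e : X.B ≃+* Matrix (Fin 2) (Fin 2) ℚ).toAddEquiv.toIntLinearEquiv :
      X.B →ₗ[ℤ] Matrix (Fin 2) (Fin 2) ℚ) := by
    rw [hu z, hconj]
    refine ⟨fun i j => ⟨(w : Matrix (Fin 2) (Fin 2) ℤ) i j, by rw [hwQ, map_apply]⟩, ?_⟩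
    have h10 : (((w : Matrix (Fin 2) (Fin 2) ℤ) 1 0 : ℤ) : ZMod M) = 0 :=
      CongruenceSubgroup.Gamma0_mem.mp hw
    obtain ⟨n, hn⟩ := (ZMod.intCast_zmod_eq_zero_iff_dvd _ M).mp h10
    refine ⟨n, ?_⟩
    rw [hwQ, map_apply, hn, Int.cast_mul, Int.cast_natCast]
  refine ⟨e.symm z, (mem_map_ringEquiv_iff (e : X.B ≃+* Matrix (Fin 2) (Fin 2) ℚ)).mp hzO, ?_⟩
  have hιx : X.ι (e.symm z) = (X.ι.comp (e.symm : Matrix (Fin 2) (Fin 2) ℚ →ₐ[ℚ] X.B)) z := rfl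
  rw [hιx, hg z]
  -- both sides are `g u w u⁻¹ g⁻¹` over `ℝ`
  have hzR : z.map (algebraMap ℚ ℝ) =
      (uR : Matrix (Fin 2) (Fin 2) ℝ) *
        ((Matrix.SpecialLinearGroup.mapGL ℝ w : GL (Fin 2) ℝ) : Matrix (Fin 2) (Fin 2) ℝ) *
        ((uR⁻¹ : GL (Fin 2) ℝ) : Matrix (Fin 2) (Fin 2) ℝ) := by
    rw [Matrix.SpecialLinearGroup.mapGL_coe_matrix, Matrix.SpecialLinearGroup.map_apply_coe,
      RingHom.mapMatrix_apply, ← map_intCast_map_algebraMap, huR, Units.coe_map, Units.coe_map_inv, hz]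
    change (algebraMap ℚ ℝ).mapMatrix _ = _
    rw [map_mul, map_mul]
    rfl
  rw [hzR]
  simp only [_root_.mul_inv_rev, Units.val_mul, mul_assoc]

/-- **`ι(O¹)` is conjugate to `Γ₀(M)` when `D = 1`.** For a Shimura curve datum of discriminant
`1` and level `M`: `0 < M`, and there is `h ∈ GL₂(ℝ)` with `h⁻¹ Γ₀^1(M) h = Γ₀(M)` (the image in
`GL₂(ℝ)` of Mathlib's `CongruenceSubgroup.Gamma0 M`): `B ≃ M₂(ℚ)` (step 2), the Eichler order
becomes `u (ℤ ℤ; Mℤ ℤ) u⁻¹` (Vignéras II §2; tree `exists_units_forall_mem_iff_and_pos`) and the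
real splitting becomes `x ↦ g x g⁻¹` (Skolem–Noether; tree `exists_algHom_apply_eq_conj`);
`h = g u`. (Vignéras IV §1 exemple 4: `O¹` is the congruence group `Γ₀(N)` read through
`i_p(O) =` the canonical Eichler order.) [cite: VignerasLNM800, Ch. IV §1 exemple 4 (groupes de congruence) and Ch. II §2] -/
theorem ShimuraCurveData.exists_conjAct_inv_smul_Gamma_eq_of_discr_one (X : ShimuraCurveData 1 M) :
    0 < M ∧ ∃ h : GL (Fin 2) ℝ, ConjAct.toConjAct h⁻¹ • X.Gamma =
      (CongruenceSubgroup.Gamma0 M).map (Matrix.SpecialLinearGroup.mapGL ℝ) := by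
  obtain ⟨e⟩ := X.nonempty_algEquiv_matrix_of_discr_one
  -- the transported Eichler order `e(O) = u O₀(M) u⁻¹`
  have hO' : Brandt.IsEichlerOrder (Matrix (Fin 2) (Fin 2) ℚ)
      (X.O.map ((e : X.B ≃+* Matrix (Fin 2) (Fin 2) ℚ).toAddEquiv.toIntLinearEquiv :
        X.B →ₗ[ℤ] Matrix (Fin 2) (Fin 2) ℚ)) M :=
    X.isEichlerOrder.map_ringEquiv (e : X.B ≃+* Matrix (Fin 2) (Fin 2) ℚ)
  obtain ⟨u, hMpos, hu⟩ := hO'.exists_units_forall_mem_iff_and_pos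
  -- the real splitting `ι ∘ e⁻¹` is conjugation by `g`
  obtain ⟨g, hg⟩ := Literature.LinearAlgebra.Matrix.exists_algHom_apply_eq_conj
    (X.ι.comp (e.symm : Matrix (Fin 2) (Fin 2) ℚ →ₐ[ℚ] X.B))
  set uR : GL (Fin 2) ℝ :=
    Units.map ((algebraMap ℚ ℝ).mapMatrix : Matrix (Fin 2) (Fin 2) ℚ →+* Matrix (Fin 2) (Fin 2) ℝ).toMonoidHom u
    with huR
  refine ⟨hMpos, g * uR, ?_⟩
  ext γ
  rw [mem_conjAct_inv_smul_iff, Subgroup.mem_map]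
  constructor
  · -- `h γ h⁻¹ = ι(x)`, `x ∈ O` ⟹ `γ = (u⁻¹ e(x) u)^ℝ` is integral of determinant one, `M ∣ γ₁₀`
    rintro ⟨⟨x, hxO, hx⟩, -, hdet⟩
    have hzO : e x ∈ X.O.map ((e : X.B ≃+* Matrix (Fin 2) (Fin 2) ℚ).toAddEquiv.toIntLinearEquiv :
        X.B →ₗ[ℤ] Matrix (Fin 2) (Fin 2) ℚ) :=
      (apply_mem_map_ringEquiv_iff (e : X.B ≃+* Matrix (Fin 2) (Fin 2) ℚ)).mpr hxO
    obtain ⟨hint, n, hn⟩ := (hu (e x)).mp hzO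
    choose w₀f hw₀f using hint
    set w₀ : Matrix (Fin 2) (Fin 2) ℤ := Matrix.of fun i j => w₀f i j with hw₀
    have hw₀Q : ((u⁻¹ : (Matrix (Fin 2) (Fin 2) ℚ)ˣ) : Matrix (Fin 2) (Fin 2) ℚ) * e x * u =
        w₀.map (Int.cast : ℤ → ℚ) := by
      ext i j
      rw [map_apply, hw₀, of_apply, hw₀f i j]
    have hιx : X.ι x = (X.ι.comp (e.symm : Matrix (Fin 2) (Fin 2) ℚ →ₐ[ℚ] X.B)) (e x) := by
      rw [AlgHom.comp_apply]
      change X.ι x = X.ι (e.symm (e x))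
      rw [AlgEquiv.symm_apply_apply]
    -- `(e x)^ℝ = u^ℝ γ (u^ℝ)⁻¹`
    have e1 : (g : Matrix (Fin 2) (Fin 2) ℝ) * (e x).map (algebraMap ℚ ℝ) *
        ((g⁻¹ : GL (Fin 2) ℝ) : Matrix (Fin 2) (Fin 2) ℝ) =
        ((g * uR * γ * (g * uR)⁻¹ : GL (Fin 2) ℝ) : Matrix (Fin 2) (Fin 2) ℝ) := by
      rw [← hg (e x), ← hιx, hx]
    have e2 : (e x).map (algebraMap ℚ ℝ) = ((uR * γ * uR⁻¹ : GL (Fin 2) ℝ) : Matrix (Fin 2) (Fin 2) ℝ) := by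
      have e3 : (e x).map (algebraMap ℚ ℝ) = ((g⁻¹ : GL (Fin 2) ℝ) : Matrix (Fin 2) (Fin 2) ℝ) *
          ((g * uR * γ * (g * uR)⁻¹ : GL (Fin 2) ℝ) : Matrix (Fin 2) (Fin 2) ℝ) *
          (g : Matrix (Fin 2) (Fin 2) ℝ) := by
        rw [← e1]
        simp only [← mul_assoc, Units.inv_mul, one_mul]
        rw [mul_assoc, Units.inv_mul, mul_one]
      rw [e3, ← Units.val_mul, ← Units.val_mul]
      congr 1
      group
    have hγ : (γ : Matrix (Fin 2) (Fin 2) ℝ) = w₀.map (algebraMap ℤ ℝ) := by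
      have e4 : γ = uR⁻¹ * (uR * γ * uR⁻¹) * uR := by group
      conv_lhs => rw [e4]
      rw [Units.val_mul, Units.val_mul, ← e2, ← map_intCast_map_algebraMap, ← hw₀Q, huR,
        Units.coe_map, Units.coe_map_inv]
      change _ = (algebraMap ℚ ℝ).mapMatrix _
      rw [map_mul, map_mul]
      rfl
    -- determinant one
    have hdetγ : Matrix.GeneralLinearGroup.det γ = 1 := by
      rw [map_mul, map_mul, map_inv, mul_inv_cancel_comm] at hdet
      exact hdet
    have hdetw₀ : w₀.det = 1 := by
      have h1 : Matrix.det (γ : Matrix (Fin 2) (Fin 2) ℝ) = 1 := by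
        have := congrArg Units.val hdetγ
        simpa using this
      have h2 : ((w₀.det : ℤ) : ℝ) = 1 := by
        rw [← eq_intCast (algebraMap ℤ ℝ), RingHom.map_det, RingHom.mapMatrix_apply, ← hγ, h1]
      exact_mod_cast h2
    -- the level condition
    have h10 : (M : ℤ) ∣ w₀ 1 0 := by
      refine ⟨n, ?_⟩
      have h1 : ((w₀ 1 0 : ℤ) : ℚ) = (M : ℚ) * n := by
        rw [← hn, hw₀Q, map_apply]
      exact_mod_cast h1
    refine ⟨⟨w₀, hdetw₀⟩, ?_, ?_⟩
    · rw [CongruenceSubgroup.Gamma0_mem]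
      exact (ZMod.intCast_zmod_eq_zero_iff_dvd _ M).mpr h10
    · apply Units.ext
      rw [Matrix.SpecialLinearGroup.mapGL_coe_matrix, hγ]
      rfl
  · -- `w ∈ Γ₀(M)` ⟹ `h w h⁻¹ = ι(e⁻¹(u w u⁻¹))` with `e⁻¹(u w^{±1} u⁻¹) ∈ O`
    rintro ⟨w, hw, rfl⟩
    obtain ⟨x, hxO, hx⟩ := X.exists_mem_O_ι_eq_conj e u hu g uR huR hg w hw
    obtain ⟨y, hyO, hy⟩ := X.exists_mem_O_ι_eq_conj e u hu g uR huR hg w⁻¹ (inv_mem hw)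
    refine ⟨⟨x, hxO, hx⟩, ⟨y, hyO, ?_⟩, ?_⟩
    · rw [hy, map_inv]
      congr 1
      group
    · rw [map_mul, map_mul, map_inv, mul_inv_cancel_comm, Matrix.SpecialLinearGroup.det_mapGL]

end Conjugate

/-! ## 4. Shimizu's formula for `D = 1` -/

section Volume

variable {M : ℕ}

open Literature.NumberTheory.EllipticCurves.ModularForms (gamma0Index) in
/-- **Shimizu's volume formula, case `D = 1`: `vol(X.fd) = (π/3) φ(1) ψ(M)`** for EVERY Shimura
curve datum `X` of level `(1, M)`, `M ≥ 1` — the instance `D = 1` of the named fact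
`ShimuraCurveData.volume_fd_eq`, verbatim (Vignéras IV §3.A with `D = 1`, `N₀ = M`,
`N₁ = N₂ = 1`: `vol_a = -(1/6) M ∏_{p∣M}(1+p⁻¹)` for the Euler–Poincaré measure `-dx dy/(2π y²)`,
i.e. hyperbolic area `(π/3) ψ(M)`). Proof: `h⁻¹ X.fd` is a fundamental domain of
`h⁻¹ ι(O¹) h = Γ₀(M)` (step 3; tree `IsHypFundamentalDomain.conjAct_inv_smul`) of area
`[SL₂(ℤ) : Γ₀(M)] · π/3 = (π/3) ψ(M)` (tree `volume_eq_of_isHypFundamentalDomain_gamma0`), and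
`vol(h⁻¹ X.fd) = vol(X.fd)` (`GL₂(ℝ)`-invariance of `dx dy/y²`). [cite: VignerasLNM800, Ch. IV §3.A (volume des groupes de congruence), case D = 1] -/
theorem ShimuraCurveData.volume_fd_eq_of_discr_one (X : ShimuraCurveData 1 M) (hM : 0 < M) :
    volume X.fd = ENNReal.ofReal (Real.pi / 3 * ((Nat.totient 1 * gamma0Index M : ℕ) : ℝ)) := by
  haveI : NeZero M := ⟨hM.ne'⟩
  obtain ⟨-, h, hh⟩ := X.exists_conjAct_inv_smul_Gamma_eq_of_discr_one
  have hF₁ : IsHypFundamentalDomain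
      ((CongruenceSubgroup.Gamma0 M).map (Matrix.SpecialLinearGroup.mapGL ℝ)) (h⁻¹ • X.fd) := by
    rw [← hh]
    exact X.isHypFundamentalDomain_fd.conjAct_inv_smul h
  rw [← measure_smul (μ := (volume : Measure UpperHalfPlane)) h⁻¹ X.fd,
    volume_eq_of_isHypFundamentalDomain_gamma0 M hF₁, Nat.totient_one, one_mul]

end Volume

end Literature.NumberTheory.Automorphic

end
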